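import Summits.NavierStokesRegularity.FunctionalMining.TopEigDensityLine
import HarnessLib

/-!
# FunctionalMining — the channels of the density in an eigenframe: the kernel's inverse-free channel
# equals SIEVELD's `∑_{a≥2} ⟨e_a, S′e₁⟩²/(λ₁ − λ_a)` at a simple eigenvalue (F1 PART I, Prop. 3 / (1))

Search for candidate a priori estimates; no regularity claim. Cell `pub-nsfunc`, prove seat
(gen 22). `TopEigDensityLine.lean` proves the channel identity `e′ᵀA′e = μ|e′|² − e′ᵀAe′` for a
differentiable eigenpair `A e = μ e` along a line, with no simplicity hypothesis. The no-go seat's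
F1 PART I writes the same quantity, where `μ = λ₁` is SIMPLE, in an eigenframe `(e, e₂, e₃)` as the
"rotation" and "tilt" channels `∑_{a≥2} ⟨e_a, ∂S e₁⟩²/(λ₁ − λ_a)` of SIEVELD's density (1)
(`∂e₁ = R w`, `R = (λ₁ − S)⁻¹` on `e₁^⊥`). This file is the algebra linking the two (any finite
dimension, any eigenvalue separated from the rest of the frame's spectrum):

* `TopEig.frame_coeff_of_eigenEquation_deriv` — from `A′e + Ae′ = μ′e + μe′` and an eigenvector `u`
  of the symmetric `A` with `Au = κu`, `u ⊥ e`: `(μ − κ)(u·e′) = u·(A′e)` (first-order perturbation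
  coefficients);
* `TopEig.dotProduct_eq_sum_frame` — Parseval's bilinear form `x·y = ∑_a (x·u_a)(u_a·y)` for a frame
  with `x = ∑_a (x·u_a) u_a`;
* **`TopEig.eigenpair_channel_eq_sum_frame`** — if `(u_a)` is such a frame of eigenvectors of `A(t₀)`,
  `u_{a₀} = e(t₀)`, `u_a ⊥ e(t₀)` and `κ_a ≠ μ(t₀)` for `a ≠ a₀`, then
  `e′ᵀ A′ e = ∑_{a ≠ a₀} (u_aᵀ A′ e)² / (μ − κ_a)`;
  with `TopEig.eigenpair_channel_eq` this reads `e′ᵀ(μ − A)e′ = ∑_{a≠a₀} (u_aᵀA′e)²/(μ − κ_a)`, each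
  term `≥ 0` when `μ` is the top eigenvalue.

The completeness of the frame is taken as the hypothesis `x = ∑_a (x·u_a) u_a` (what the spectral
theorem provides); nothing else is assumed. [ours; folklore — first-order perturbation theory]
-/

noncomputable section

open Filter Topology Matrix

namespace Summit.NavierStokesRegularity.FunctionalMining

namespace TopEig

variable {d : Type*} [Fintype d]

/-- **First-order coefficients.** If `A′e + Ae′ = μ′e + μe′` (the differentiated eigen-equation),
`A` is symmetric, `Au = κu` and `u ⊥ e`, then `(μ − κ)(u·e′) = u·(A′e)`. [folklore] -/
theorem frame_coeff_of_eigenEquation_deriv {A A' : Matrix d d ℝ} {e e' u : d → ℝ} {μ μ' κ : ℝ}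
    (hA : A.IsSymm) (hderiv : A' *ᵥ e + A *ᵥ e' = μ' • e + μ • e') (hu : A *ᵥ u = κ • u)
    (hue : u ⬝ᵥ e = 0) : (μ - κ) * (u ⬝ᵥ e') = u ⬝ᵥ (A' *ᵥ e) := by
  have h := congrArg (fun x => u ⬝ᵥ x) hderiv
  simp only [dotProduct_add, dotProduct_smul, smul_eq_mul, hue, mul_zero, zero_add] at h
  -- `u·(Ae′) = (Au)·e′ = κ (u·e′)` by symmetry
  have hsym : u ⬝ᵥ (A *ᵥ e') = κ * (u ⬝ᵥ e') := by
    rw [dotProduct_mulVec_comm_of_isSymm hA u e', dotProduct_comm e' (A *ᵥ u), hu, smul_dotProduct,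
      smul_eq_mul]
  rw [hsym] at h
  linarith

/-- A finite linear combination paired with a vector: `(∑_a c_a u_a)·y = ∑_a c_a (u_a·y)`. [folklore] -/
theorem sum_smul_dotProduct {ι : Type*} [Fintype ι] (c : ι → ℝ) (u : ι → d → ℝ) (y : d → ℝ) :
    (∑ a, c a • u a) ⬝ᵥ y = ∑ a, c a * (u a ⬝ᵥ y) := by
  simp only [dotProduct, Finset.sum_apply, Pi.smul_apply, smul_eq_mul, Finset.mul_sum, Finset.sum_mul]
  rw [Finset.sum_comm]
  exact Finset.sum_congr rfl fun a _ => Finset.sum_congr rfl fun i _ => by ring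

/-- **Parseval's bilinear form for a complete frame**: if `x = ∑_a (x·u_a) u_a` then
`x·y = ∑_a (x·u_a)(u_a·y)`. [folklore] -/
theorem dotProduct_eq_sum_frame {ι : Type*} [Fintype ι] {u : ι → d → ℝ} {x : d → ℝ}
    (hx : x = ∑ a, (x ⬝ᵥ u a) • u a) (y : d → ℝ) :
    x ⬝ᵥ y = ∑ a, (x ⬝ᵥ u a) * (u a ⬝ᵥ y) := by
  conv_lhs => rw [hx]
  exact sum_smul_dotProduct _ u y

/-- **THE CHANNELS IN AN EIGENFRAME (F1 PART I, density (1) vs. the kernel's inverse-free form).**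
Hypotheses of `eigenpair_channel_eq` (a differentiable eigenpair `A(t)e(t) = μ(t)e(t)`, `|e| = 1`,
`A(t₀)` symmetric) plus a complete frame `(u_a)` of eigenvectors of `A(t₀)`, `A(t₀)u_a = κ_a u_a`,
containing `e(t₀) = u_{a₀}`, with `u_a ⊥ e(t₀)` and `κ_a ≠ μ(t₀)` for `a ≠ a₀`. Then
`e′ᵀ A′ e = ∑_{a ≠ a₀} (u_aᵀ A′ e)²/(μ − κ_a)` — SIEVELD's rotation/tilt channels
`∑_{a≥2}⟨e_a, S′e₁⟩²/(λ₁ − λ_a)`. [ours; folklore] -/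
theorem eigenpair_channel_eq_sum_frame {ι : Type*} [Fintype ι] [DecidableEq ι]
    {A : ℝ → Matrix d d ℝ} {A' : Matrix d d ℝ} {e : ℝ → d → ℝ} {e' : d → ℝ} {μ : ℝ → ℝ} {t₀ : ℝ}
    (hA : ∀ i j, HasDerivAt (fun t => A t i j) (A' i j) t₀)
    (he : ∀ i, HasDerivAt (fun t => e t i) (e' i) t₀) (hsymm : (A t₀).IsSymm)
    (heig : ∀ᶠ t in 𝓝 t₀, A t *ᵥ e t = μ t • e t) (hunit : ∀ᶠ t in 𝓝 t₀, e t ⬝ᵥ e t = 1)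
    {u : ι → d → ℝ} {κ : ι → ℝ} {a₀ : ι} (hu : ∀ a, A t₀ *ᵥ u a = κ a • u a) (hu₀ : u a₀ = e t₀)
    (horth : ∀ a, a ≠ a₀ → u a ⬝ᵥ e t₀ = 0) (hgap : ∀ a, a ≠ a₀ → κ a ≠ μ t₀)
    (hspan : ∀ x : d → ℝ, x = ∑ a, (x ⬝ᵥ u a) • u a) :
    e' ⬝ᵥ (A' *ᵥ e t₀) =
      ∑ a ∈ Finset.univ.erase a₀, (u a ⬝ᵥ (A' *ᵥ e t₀)) ^ 2 / (μ t₀ - κ a) := by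
  have hμ := hasDerivAt_eigenvalue_line hA he hsymm heig hunit
  have hderiv := eigenEquation_deriv hA he hμ heig
  have h0 : e' ⬝ᵥ e t₀ = 0 := dotProduct_deriv_eq_zero_of_unit he hunit
  -- Parseval
  rw [dotProduct_eq_sum_frame (hspan e') (A' *ᵥ e t₀), ← Finset.add_sum_erase _ _ (Finset.mem_univ a₀)]
  have hzero : (e' ⬝ᵥ u a₀) * (u a₀ ⬝ᵥ (A' *ᵥ e t₀)) = 0 := by rw [hu₀, h0, zero_mul]
  rw [hzero, zero_add]
  refine Finset.sum_congr rfl fun a ha => ?_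
  have hne : a ≠ a₀ := (Finset.mem_erase.1 ha).1
  have hc := frame_coeff_of_eigenEquation_deriv hsymm hderiv (hu a) (horth a hne)
  have hgap' : μ t₀ - κ a ≠ 0 := sub_ne_zero.2 (Ne.symm (hgap a hne))
  -- `e′·u_a = (u_a·A′e)/(μ − κ_a)`
  have hcoef : e' ⬝ᵥ u a = (u a ⬝ᵥ (A' *ᵥ e t₀)) / (μ t₀ - κ a) := by
    rw [eq_div_iff hgap', dotProduct_comm]
    linarith [hc]
  rw [hcoef]
  ring

/-- The same as an identity for the inverse-free channel: under the hypotheses above,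
`μ|e′|² − e′ᵀAe′ = ∑_{a ≠ a₀} (u_aᵀA′e)²/(μ − κ_a)` (`= ⟨R w, w⟩` of F1 PART I (1)); when `μ` is the
top eigenvalue every term has `μ − κ_a > 0`. [ours] -/
theorem eigenpair_channel_inverseFree_eq_sum_frame {ι : Type*} [Fintype ι] [DecidableEq ι]
    {A : ℝ → Matrix d d ℝ} {A' : Matrix d d ℝ} {e : ℝ → d → ℝ} {e' : d → ℝ} {μ : ℝ → ℝ} {t₀ : ℝ}
    (hA : ∀ i j, HasDerivAt (fun t => A t i j) (A' i j) t₀)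
    (he : ∀ i, HasDerivAt (fun t => e t i) (e' i) t₀) (hsymm : (A t₀).IsSymm)
    (heig : ∀ᶠ t in 𝓝 t₀, A t *ᵥ e t = μ t • e t) (hunit : ∀ᶠ t in 𝓝 t₀, e t ⬝ᵥ e t = 1)
    {u : ι → d → ℝ} {κ : ι → ℝ} {a₀ : ι} (hu : ∀ a, A t₀ *ᵥ u a = κ a • u a) (hu₀ : u a₀ = e t₀)
    (horth : ∀ a, a ≠ a₀ → u a ⬝ᵥ e t₀ = 0) (hgap : ∀ a, a ≠ a₀ → κ a ≠ μ t₀)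
    (hspan : ∀ x : d → ℝ, x = ∑ a, (x ⬝ᵥ u a) • u a) :
    μ t₀ * (e' ⬝ᵥ e') - e' ⬝ᵥ (A t₀ *ᵥ e') =
      ∑ a ∈ Finset.univ.erase a₀, (u a ⬝ᵥ (A' *ᵥ e t₀)) ^ 2 / (μ t₀ - κ a) := by
  rw [← eigenpair_channel_eq hA he hsymm heig hunit]
  exact eigenpair_channel_eq_sum_frame hA he hsymm heig hunit hu hu₀ horth hgap hspan

end TopEig

end Summit.NavierStokesRegularity.FunctionalMining

end
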